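import Literature.Topology.FourManifolds.TautFoliationsDiscAtlas
import Literature.Topology.FourManifolds.TautFoliationsCheckerboard
import Literature.Topology.PlanarFoliations.OrderIsoExtend
import Literature.Topology.PlanarFoliations.BiOrient
import Mathlib.Algebra.Group.Nat.Even
import HarnessLib

/-!
# The contour foliation of a disc in checkerboard cone position

Topic: assembly of `TautFoliationsDiscAtlas` (the planar side) with `TautFoliationsConePosition`,
`TautFoliationsCheckerboard`, `TautFoliationsGoodSubbox` and `PlanarFoliations.OrderIsoExtend`
(the manifold side). For a cone position `P` of a square with respect to a transversely
oriented codimension-one foliation `F`: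

* `ConePosition.roofPat` (**definition**): the checkerboard pattern `Even (q.1 + q.2)`
  (`roofPat_edgeNb`: opposite on edge-neighbours); `adj_of_edgeNb`;
* `ConePosition.exists_sigma` (**proved**): for edge-neighbours `q, q'`, an order isomorphism
  `σ : ℝ ≃o ℝ` with `h_{e_q} = σ ∘ h_{e_{q'}}` on the part of the sub-box of `q'` of height within
  `3ρ/4` of its centre (the Hector–Hirsch transition of `TautFoliationsGoodSubbox`, extended by
  `orderIsoExtend`); `ConePosition.sigma` and `sigma_spec`;
* `ConePosition.datum P ho` (**definition**): the checkerboard datum of `P` (apexes from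
  `exists_apex`, boundary heights `bdryHt`, conversions `sigma`), hence the **contour foliation**
  `(P.datum ho).foliation : Foliation ℝ X₀` of the punctured open square, transversely oriented;
* `ConePosition.H_eq_height_fill`, `ConePosition.chart_height` (**proved**): every plane chart
  of the datum reads, as height, the `e_q`-height of the filled map `fill` for one box `e_q`
  containing the image of its source;
* `ConePosition.samePlaque_fill` (**proved**): points on a common plaque of the contour
  foliation are mapped by `fill` to points on a common plaque of `F`;
  `ConePosition.fill_mem_leaf` (**proved**): `fill` maps every leaf of the contour foliation
  into a leaf of `F`;
* `Grid.planeEmb` (**definition**, an open embedding `X₀ → ℂ`) and `ConePosition.contourFol`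
  (**definition**): the bi-oriented version (`PlanarFoliations.biOrient`) of the contour
  foliation — same leaves, transversely oriented and bi-oriented
  (`isBiOriented_contourFol`, `isTransverselyOriented_contourFol`, `leaf_contourFol`,
  `fill_mem_leaf'`), ready for the Poincaré–Bendixson theory of `PlanarFoliations`.

All statements are [folklore] (C⁰ version of Camacho–Lins Neto, Ch. VI §3: the induced singular
foliation of a disc in general position, here for the checkerboard choice of apexes).
-/

noncomputable section

open Set Filter Metric Topology
open Literature.Topology.PlanarFoliations

namespace Literature.Topology.FourManifolds

open ConeSquare SquareGrid

namespace Foliation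

variable {B : Type*} [NormedAddCommGroup B] [NormedSpace ℝ B] {M : Type*} [TopologicalSpace M]
  {F : Foliation B M} {f : ℝ × ℝ → M} {c₀ : ℝ × ℝ} {L : ℝ} {hL : 0 < L}

namespace ConePosition

variable (P : ConePosition F f c₀ hL)

/-! ## The checkerboard pattern -/

/-- **The checkerboard pattern**: roof squares are those of even index sum. [folklore] -/
def roofPat (q : Fin P.n × Fin P.n) : Prop := Even ((q.1 : ℕ) + q.2)

omit [NormedSpace ℝ B] in
/-- Edge-neighbours have opposite patterns. [folklore] -/
theorem roofPat_edgeNb {q q' : Fin P.n × Fin P.n} (h : P.gr.EdgeNb q q') : P.roofPat q ↔ ¬ P.roofPat q' := by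
  unfold roofPat
  rcases h with ⟨h1, h2⟩ | ⟨h1, h2⟩ | ⟨h1, h2⟩ | ⟨h1, h2⟩
  · have : (q'.1 : ℕ) + q'.2 = ((q.1 : ℕ) + q.2) + 1 := by rw [h1, h2]; ring
    rw [this, Nat.even_add_one, not_not]
  · have : (q.1 : ℕ) + q.2 = ((q'.1 : ℕ) + q'.2) + 1 := by rw [h1, h2]; ring
    rw [this, Nat.even_add_one]
  · have : (q'.1 : ℕ) + q'.2 = ((q.1 : ℕ) + q.2) + 1 := by rw [h1, h2]; ring
    rw [this, Nat.even_add_one, not_not]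
  · have : (q.1 : ℕ) + q.2 = ((q'.1 : ℕ) + q'.2) + 1 := by rw [h1, h2]; ring
    rw [this, Nat.even_add_one]

omit [NormedSpace ℝ B] in
/-- Edge-neighbours are adjacent. [folklore] -/
theorem adj_of_edgeNb {q q' : Fin P.n × Fin P.n} (h : P.gr.EdgeNb q q') : P.gr.Adj q q' := by
  rcases h with ⟨h1, h2⟩ | ⟨h1, h2⟩ | ⟨h1, h2⟩ | ⟨h1, h2⟩
  · have h2' : (q'.2 : ℕ) = q.2 := by rw [h2]
    exact ⟨by omega, by omega, by omega, by omega⟩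
  · have h2' : (q.2 : ℕ) = q'.2 := by rw [h2]
    exact ⟨by omega, by omega, by omega, by omega⟩
  · have h1' : (q'.1 : ℕ) = q.1 := by rw [h1]
    exact ⟨by omega, by omega, by omega, by omega⟩
  · have h1' : (q.1 : ℕ) = q'.1 := by rw [h1]
    exact ⟨by omega, by omega, by omega, by omega⟩

/-! ## The height conversions -/

/-- The height interval of the sub-box of `q'` used for the conversions. [folklore] -/
def convIcc (q' : Fin P.n × Fin P.n) : Set ℝ := Icc ((P.ctr q').2 - 3 * P.ρ / 4) ((P.ctr q').2 + 3 * P.ρ / 4)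

omit [NormedSpace ℝ B] in
/-- The conversion interval contains the height ball of radius `ρ / 2`. [folklore] -/
theorem ball_subset_convIcc (q' : Fin P.n × Fin P.n) : ball (P.ctr q').2 (P.ρ / 2) ⊆ P.convIcc q' := by
  intro t ht
  rw [mem_ball, Real.dist_eq, abs_lt] at ht
  have := P.hρ
  show t ∈ Icc _ _
  exact ⟨by linarith [ht.1], by linarith [ht.2]⟩

/-- **Existence of the height conversion** between the boxes of edge-neighbours. [folklore] -/
theorem exists_sigma (ho : F.IsTransverselyOriented) {q q' : Fin P.n × Fin P.n} (h : P.gr.EdgeNb q q') :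
    ∃ σ : ℝ ≃o ℝ, ∀ u ∈ subbox (P.box q') (P.ctr q') P.ρ, height (P.box q') u ∈ P.convIcc q' →
      height (P.box q) u = σ (height (P.box q') u) := by
  have hρ := P.hρ
  have hsub : subbox (P.box q') (P.ctr q') P.ρ ⊆ (P.box q).source :=
    P.subbox_subset q' q (P.adj_of_edgeNb h.symm)
  obtain ⟨γ, hγc, hγm, hγ⟩ := ho.exists_transitionOn (P.box_mem q') (P.box_mem q) hsub
  have hIcc : P.convIcc q' ⊆ ball (P.ctr q').2 P.ρ := by
    intro t ht
    rw [mem_ball, Real.dist_eq, abs_lt]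
    simp only [convIcc, mem_Icc] at ht
    constructor <;> linarith [ht.1, ht.2]
  have hle : (P.ctr q').2 - 3 * P.ρ / 4 ≤ (P.ctr q').2 + 3 * P.ρ / 4 := by linarith
  refine ⟨orderIsoExtend γ _ _ hle (hγc.mono hIcc) (hγm.mono hIcc), fun u hu ht ↦ ?_⟩
  rw [orderIsoExtend_apply_of_mem hle (hγc.mono hIcc) (hγm.mono hIcc) ht]
  exact hγ u hu

/-- **The height conversions** (identity on non-neighbours). [folklore] -/
def sigma (ho : F.IsTransverselyOriented) (q q' : Fin P.n × Fin P.n) : ℝ ≃o ℝ := by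
  classical
  exact if h : P.gr.EdgeNb q q' then (P.exists_sigma ho h).choose else OrderIso.refl ℝ

/-- The defining property of the conversions. [folklore] -/
theorem sigma_spec (ho : F.IsTransverselyOriented) {q q' : Fin P.n × Fin P.n} (h : P.gr.EdgeNb q q')
    {u : M} (hu : u ∈ subbox (P.box q') (P.ctr q') P.ρ) (ht : height (P.box q') u ∈ P.convIcc q') :
    height (P.box q) u = P.sigma ho q q' (height (P.box q') u) := by
  classical
  rw [sigma, dif_pos h]
  exact (P.exists_sigma ho h).choose_spec u hu ht

/-! ## The checkerboard datum of a cone position -/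

/-- **The checkerboard apex heights.** [folklore] -/
def apex : Fin P.n × Fin P.n → ℝ := (P.exists_apex P.roofPat).choose

omit [NormedSpace ℝ B] in
/-- The checkerboard apex heights are admissible, roofs on even squares, floors on odd ones.
[folklore] -/
theorem apex_spec : P.AdmissibleApex P.apex ∧
    (∀ q, P.roofPat q → ∀ y ∈ sphere (P.gr.centre q) P.gr.ℓ, P.bdryHt q y < P.apex q) ∧
    (∀ q, ¬ P.roofPat q → ∀ y ∈ sphere (P.gr.centre q) P.gr.ℓ, P.apex q < P.bdryHt q y) :=
  (P.exists_apex P.roofPat).choose_spec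

/-- **The checkerboard datum of the cone position.** [folklore] -/
def datum (ho : F.IsTransverselyOriented) : CheckerboardDatum P.gr where
  m := P.apex
  ψ := P.bdryHt
  roof := P.roofPat
  σ := P.sigma ho
  cont := P.continuousOn_bdryHt
  lt_apex := P.apex_spec.2.1
  apex_lt := P.apex_spec.2.2
  checker _ _ h := P.roofPat_edgeNb h
  compat q q' h _ _ y hy := by
    have hu : P.skel y ∈ subbox (P.box q') (P.ctr q') P.ρ :=
      subbox_mono _ _ (by linarith [P.hρ]) (P.skel_mem_of_mem_sphere hy.2)
    have ht : height (P.box q') (P.skel y) ∈ P.convIcc q' := P.ball_subset_convIcc q' (P.bdryHt_mem_ball hy.2)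
    exact P.sigma_spec ho h hu ht

/-- The apexes of the datum. [folklore] -/
@[simp] theorem datum_m (ho : F.IsTransverselyOriented) : (P.datum ho).m = P.apex := rfl

/-- The boundary heights of the datum. [folklore] -/
@[simp] theorem datum_ψ (ho : F.IsTransverselyOriented) : (P.datum ho).ψ = P.bdryHt := rfl

/-- The conversions of the datum. [folklore] -/
@[simp] theorem datum_σ (ho : F.IsTransverselyOriented) : (P.datum ho).σ = P.sigma ho := rfl

/-! ## The chart heights are box heights of the filled map -/

/-- **The cone height of the datum on the square `q` is the `e_q`-height of the filled map.**
[folklore] -/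
theorem H_eq_height_fill (ho : F.IsTransverselyOriented) {q : Fin P.n × Fin P.n} {y : ℝ × ℝ} (hy : y ∈ P.gr.sq q) :
    (P.datum ho).H q y = height (P.box q) (P.fill P.apex y) := by
  rw [CheckerboardDatum.H, coneHt_apply, P.height_fill hy]
  rfl

/-- The filled map sends the open square of `q'` into the conversion range of `q'`. [folklore] -/
theorem height_fill_mem_convIcc {q' : Fin P.n × Fin P.n} {y : ℝ × ℝ} (hy : y ∈ P.gr.sq q') :
    height (P.box q') (P.fill P.apex y) ∈ P.convIcc q' :=
  P.ball_subset_convIcc q' (F.height_mem_ball_of_mem_subbox (P.box_mem q') (P.fill_mem_subbox P.apex_spec.1 hy))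

/-- **Every plane chart of the datum reads the `e_q`-height of the filled map, for one box `e_q`
whose source contains the image of the chart source.** [folklore] -/
theorem chart_height (ho : F.IsTransverselyOriented) {ĉ : OpenPartialHomeomorph (ℝ × ℝ) (ℝ × ℝ)}
    (hĉ : (P.datum ho).IsPlaneChart ĉ) :
    ∃ q₀, ∀ y ∈ ĉ.source, P.fill P.apex y ∈ (P.box q₀).source ∧ (ĉ y).2 = height (P.box q₀) (P.fill P.apex y) := by
  have hadm := P.apex_spec.1
  rcases hĉ with ⟨q, h, k, rfl⟩ | ⟨q, h, k, rfl⟩ | ⟨q, q', T, hn, hr, hf, E, rfl⟩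
  · refine ⟨q, fun y hy ↦ ?_⟩
    have hyq : y ∈ P.gr.sq q := ball_subset_closedBall ((P.datum ho).roofChart_source_subset h k hy)
    exact ⟨P.fill_mem_source hadm hyq, by rw [(P.datum ho).roofChart_snd h k y, P.H_eq_height_fill ho hyq]⟩
  · refine ⟨q, fun y hy ↦ ?_⟩
    have hyq : y ∈ P.gr.sq q := ball_subset_closedBall ((P.datum ho).floorChart_source_subset h k hy)
    exact ⟨P.fill_mem_source hadm hyq, by rw [(P.datum ho).floorChart_snd h k y, P.H_eq_height_fill ho hyq]⟩
  · refine ⟨q, fun y hy ↦ ?_⟩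
    rcases E.source_subset hy with (hb | hb) | he
    · have hyq : y ∈ P.gr.sq q := ball_subset_closedBall hb
      exact ⟨P.fill_mem_source hadm hyq, by rw [E.chart_snd_of_mem_ball_left hb]; exact P.H_eq_height_fill ho hyq⟩
    · have hyq' : y ∈ P.gr.sq q' := ball_subset_closedBall hb
      refine ⟨P.fill_mem_source_of_adj hadm (P.adj_of_edgeNb hn.symm) hyq', ?_⟩
      rw [E.chart_snd_of_mem_ball_right hb]
      show P.sigma ho q q' ((P.datum ho).H q' y) = _
      rw [P.H_eq_height_fill ho hyq']
      have hu : P.fill P.apex y ∈ subbox (P.box q') (P.ctr q') P.ρ :=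
        subbox_mono _ _ (by linarith [P.hρ]) (P.fill_mem_subbox hadm hyq')
      exact (P.sigma_spec ho hn hu (P.height_fill_mem_convIcc hyq')).symm
    · have hyq : y ∈ P.gr.sq q := P.gr.sphere_subset_sq q he.1
      refine ⟨P.fill_mem_source hadm hyq, ?_⟩
      rw [E.chart_snd_eq_canonHt hy, EdgeDataAt.canonHt, if_pos (by have := he.1; rw [mem_sphere] at this; exact this.le)]
      exact P.H_eq_height_fill ho hyq

/-! ## The filled map sends leaves into leaves -/

/-- **Points on a common plaque of the contour foliation are sent to a common plaque of `F`.**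
[folklore] -/
theorem samePlaque_fill (ho : F.IsTransverselyOriented) {e : OpenPartialHomeomorph (P.gr.X₀) (ℝ × ℝ)}
    (he : e ∈ (P.datum ho).foliation.atlas) {y z : P.gr.X₀} (hy : y ∈ e.source) (hz : z ∈ e.source)
    (h : (e y).2 = (e z).2) : F.SamePlaque (P.fill P.apex y) (P.fill P.apex z) := by
  haveI := P.gr.nonempty_X₀
  obtain ⟨c, ⟨ĉ, hĉ, rfl⟩, p, r, hr, -, rfl⟩ := he
  obtain ⟨q₀, hq₀⟩ := P.chart_height ho hĉ
  have hy' : (y : ℝ × ℝ) ∈ ĉ.source := by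
    have := renormBox_source_subset _ _ _ _ hy
    rwa [OpenPartialHomeomorph.subtypeRestr_source] at this
  have hz' : (z : ℝ × ℝ) ∈ ĉ.source := by
    have := renormBox_source_subset _ _ _ _ hz
    rwa [OpenPartialHomeomorph.subtypeRestr_source] at this
  obtain ⟨hys, hyh⟩ := hq₀ _ hy'
  obtain ⟨hzs, hzh⟩ := hq₀ _ hz'
  refine ⟨P.box q₀, P.box_mem q₀, hys, hzs, ?_⟩
  rw [renormBox_snd_eq_iff hy hz] at h
  change (ĉ y).2 = (ĉ z).2 at h
  rw [hyh, hzh] at h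
  exact h

/-- **The filled map sends every leaf of the contour foliation into a leaf of `F`.** [folklore] -/
theorem fill_mem_leaf (ho : F.IsTransverselyOriented) {x y : P.gr.X₀} (h : y ∈ (P.datum ho).foliation.leaf x) :
    P.fill P.apex y ∈ F.leaf (P.fill P.apex x) := by
  rw [mem_leaf_iff] at h ⊢
  induction h with
  | rel a b hab =>
    obtain ⟨e, he, ha, hb, hh⟩ := hab
    exact Relation.EqvGen.rel _ _ (P.samePlaque_fill ho he ha hb hh)
  | refl a => exact Relation.EqvGen.refl _
  | symm a b _ ih => exact Relation.EqvGen.symm _ _ ih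
  | trans a b c _ _ ih₁ ih₂ => exact Relation.EqvGen.trans _ _ _ ih₁ ih₂

end ConePosition

end Foliation

/-! ## The plane embedding of the carrier and the bi-oriented contour foliation -/

namespace SquareGrid.Grid

/-- **The plane embedding of the carrier**: inclusion into `ℝ × ℝ` followed by the
identification with `ℂ`. [folklore] -/
def planeEmb (g : Grid) (x : g.X₀) : ℂ := Complex.equivRealProdCLM.symm (x : ℝ × ℝ)

/-- The plane embedding is an open embedding. [folklore] -/
theorem isOpenEmbedding_planeEmb (g : Grid) : IsOpenEmbedding g.planeEmb :=
  Complex.equivRealProdCLM.symm.toHomeomorph.isOpenEmbedding.comp g.X₀.2.isOpenEmbedding_subtypeVal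

end SquareGrid.Grid

namespace Foliation.ConePosition

variable {B : Type*} [NormedAddCommGroup B] [NormedSpace ℝ B] {M : Type*} [TopologicalSpace M]
  {F : Foliation B M} {f : ℝ × ℝ → M} {c₀ : ℝ × ℝ} {L : ℝ} {hL : 0 < L} (P : ConePosition F f c₀ hL)

/-- **The bi-oriented contour foliation** of the cone position. [folklore] -/
def contourFol (ho : F.IsTransverselyOriented) : Foliation ℝ P.gr.X₀ := biOrient (P.datum ho).foliation P.gr.planeEmb

/-- The contour foliation is bi-oriented. [folklore] -/
theorem isBiOriented_contourFol (ho : F.IsTransverselyOriented) : IsBiOriented (P.contourFol ho) :=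
  isBiOriented_biOrient P.gr.isOpenEmbedding_planeEmb (P.datum ho).isTransverselyOriented_foliation

/-- The contour foliation is transversely oriented. [folklore] -/
theorem isTransverselyOriented_contourFol (ho : F.IsTransverselyOriented) : (P.contourFol ho).IsTransverselyOriented :=
  isTransverselyOriented_biOrient (P.datum ho).isTransverselyOriented_foliation

/-- The leaves of the contour foliation are those of the datum foliation. [folklore] -/
theorem leaf_contourFol (ho : F.IsTransverselyOriented) (x : P.gr.X₀) :
    (P.contourFol ho).leaf x = (P.datum ho).foliation.leaf x :=
  leaf_biOrient x

/-- **`fill` maps the leaves of the bi-oriented contour foliation into leaves of `F`.** [folklore] -/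
theorem fill_mem_leaf' (ho : F.IsTransverselyOriented) {x y : P.gr.X₀} (h : y ∈ (P.contourFol ho).leaf x) :
    P.fill P.apex y ∈ F.leaf (P.fill P.apex x) := by
  rw [leaf_contourFol] at h
  exact P.fill_mem_leaf ho h

end Foliation.ConePosition

end Literature.Topology.FourManifolds
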